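import Summits.AtomisticToContinuum.Crystallization.Theses.ChessboardParticlePlanes
import Literature.Algebra.EuclideanLattices.GaussianLatticeSums

/-!
# Crux `ChessboardParticlePlanes.LjPlaneChessboard` (stmt-AtomisticToContinuum-6709), line `Sketch`,
# stub `latticeFormNonneg` — a kernel with non-negative Fourier transform has a non-negative
# lattice-periodised quadratic form

Let `V` be a `2`-dimensional real inner-product space, `L ⊂ V` a full lattice with dual lattice
`L* = dualLattice L`, and `k : V → ℝ` continuous with `|k(x)| ≤ C (1 + ‖x‖)⁻³`, whose Fourier
transform `𝓕k` (Mathlib's `𝓕`, kernel `𝐞(-⟪v, w⟫)`) is pointwise real and `≥ 0` and summable over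
`L*`.  Then for every finite signed motif `(p_i, s_i)_{i < n}`
`∑_{i,j} s_i s_j ∑_{l ∈ L} k(p_i - p_j + l) ≥ 0`.

Proof (Bochner positivity through Poisson summation).  For `z ∈ V` the translate
`f_z(v) = k(z + v)` is continuous with `|f_z(v)| ≤ C (1 + ‖z‖)³ (1 + ‖v‖)⁻³`
(`latticeForm_norm_translate_le`, from `1 + ‖v‖ ≤ (1 + ‖z + v‖)(1 + ‖z‖)`), and
`𝓕f_z(w) = 𝐞(⟪z, w⟫) 𝓕k(w)` (`latticeForm_fourier_translate`, Mathlib's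
`VectorFourier.fourierIntegral_comp_add_right`), which is absolutely summable over `L*` because
`‖𝓕k(w)‖ = Re 𝓕k(w)` (`𝓕k(w)` is real and `≥ 0`).  The tree's Poisson summation formula in decay form
(`Literature.NumberTheory.LFunctions.Fourier.tsum_eq_tsum_fourier_of_rpow_decay`, exponent
`3 > 2 = dim V`) gives, after taking real parts,
`∑_{l ∈ L} k(z + l) = vol(L)⁻¹ ∑_{w ∈ L*} cos(2π⟪z, w⟫) Re 𝓕k(w)` (`latticeForm_hasSum_periodise`).
Summing over the pairs `(i, j)` with weights `s_i s_j` and using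
`∑_{i,j} s_i s_j cos(a_i - a_j) = (∑_i s_i cos a_i)² + (∑_i s_i sin a_i)²` (`latticeForm_cos_sq`)
every term of the resulting series over `L*` is `vol(L)⁻¹ · Re 𝓕k(w) · (square sum) ≥ 0`.
[folklore]
-/

noncomputable section

namespace Summit.AtomisticToContinuum.Crystallization.Theorems.ChessboardParticlePlanesLjPlaneChessboard

open Literature.Algebra.EuclideanLattices
open scoped Real InnerProductSpace FourierTransform

/-- The trigonometric square identity behind Bochner positivity for finite motifs:
`∑_{i,j} s_i s_j cos(a_i - a_j) = (∑_i s_i cos a_i)² + (∑_i s_i sin a_i)²`. [folklore] -/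
theorem latticeForm_cos_sq {n : ℕ} (s a : Fin n → ℝ) :
    ∑ i, ∑ j, s i * s j * Real.cos (a i - a j) =
      (∑ i, s i * Real.cos (a i)) ^ 2 + (∑ i, s i * Real.sin (a i)) ^ 2 := by
  simp_rw [Real.cos_sub, sq, Finset.sum_mul_sum, ← Finset.sum_add_distrib]
  refine Finset.sum_congr rfl fun i _ ↦ Finset.sum_congr rfl fun j _ ↦ ?_
  ring

section Translate

variable {V : Type*} [NormedAddCommGroup V]

/-- Decay of a translate against powers of `1 + ‖v‖`: if `|k(x)| ≤ C (1 + ‖x‖)⁻³` then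
`|k(z + v)| ≤ C (1 + ‖z‖)³ (1 + ‖v‖)⁻³`, from `1 + ‖v‖ ≤ (1 + ‖z + v‖)(1 + ‖z‖)`. [folklore] -/
theorem latticeForm_norm_translate_le {k : V → ℝ} {C : ℝ}
    (hdec : ∀ x : V, |k x| ≤ C * (1 + ‖x‖) ^ (-(3 : ℝ))) (z v : V) :
    ‖((k (z + v) : ℝ) : ℂ)‖ ≤ C * (1 + ‖z‖) ^ (3 : ℝ) * (1 + ‖v‖) ^ (-(3 : ℝ)) := by
  have hC : 0 ≤ C := by
    have h := hdec 0
    rw [norm_zero, add_zero, Real.one_rpow, mul_one] at h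
    exact (abs_nonneg _).trans h
  rw [Complex.norm_real, Real.norm_eq_abs]
  refine (hdec _).trans ?_
  -- `(1 + ‖z + v‖)⁻³ ≤ (1 + ‖z‖)³ (1 + ‖v‖)⁻³` since `1 + ‖v‖ ≤ (1 + ‖z + v‖)(1 + ‖z‖)`
  have hvz : 1 + ‖v‖ ≤ (1 + ‖z + v‖) * (1 + ‖z‖) := by
    have : ‖v‖ ≤ ‖z + v‖ + ‖z‖ := by
      calc ‖v‖ = ‖(z + v) - z‖ := by rw [add_sub_cancel_left]
        _ ≤ ‖z + v‖ + ‖z‖ := norm_sub_le _ _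
    nlinarith [norm_nonneg (z + v), norm_nonneg z]
  have h2 : (1 + ‖z + v‖) ^ (-(3 : ℝ)) ≤ (1 + ‖z‖) ^ (3 : ℝ) * (1 + ‖v‖) ^ (-(3 : ℝ)) := by
    have hpow : (1 + ‖v‖) ^ (3 : ℝ) ≤ (1 + ‖z + v‖) ^ (3 : ℝ) * (1 + ‖z‖) ^ (3 : ℝ) := by
      rw [← Real.mul_rpow (by positivity) (by positivity)]
      exact Real.rpow_le_rpow (by positivity) hvz (by norm_num)
    rw [Real.rpow_neg (by positivity), Real.rpow_neg (by positivity)]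
    rw [show ((1 + ‖z + v‖) ^ (3 : ℝ))⁻¹ =
        (1 + ‖z‖) ^ (3 : ℝ) * ((1 + ‖z + v‖) ^ (3 : ℝ) * (1 + ‖z‖) ^ (3 : ℝ))⁻¹ by
      field_simp]
    exact mul_le_mul_of_nonneg_left (inv_anti₀ (by positivity) hpow) (by positivity)
  calc C * (1 + ‖z + v‖) ^ (-(3 : ℝ))
      ≤ C * ((1 + ‖z‖) ^ (3 : ℝ) * (1 + ‖v‖) ^ (-(3 : ℝ))) := mul_le_mul_of_nonneg_left h2 hC
    _ = _ := by ring

end Translate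

section Periodise

variable {V : Type*} [NormedAddCommGroup V] [InnerProductSpace ℝ V] [FiniteDimensional ℝ V]
  [MeasurableSpace V] [BorelSpace V]

/-- The Fourier transform converts translation into a phase:
`𝓕[k(z + ·)](w) = 𝐞(⟪z, w⟫) 𝓕k(w)` (Mathlib's `VectorFourier.fourierIntegral_comp_add_right`).
[folklore] -/
theorem latticeForm_fourier_translate (k : V → ℝ) (z w : V) :
    𝓕 (fun v : V => ((k (z + v) : ℝ) : ℂ)) w = 𝐞 (⟪z, w⟫_ℝ) • 𝓕 (fun v : V => (k v : ℂ)) w := by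
  have hF : (fun v : V => ((k (z + v) : ℝ) : ℂ)) = (fun v : V => ((k v : ℝ) : ℂ)) ∘ fun v => v + z := by
    funext v
    simp only [Function.comp_apply, add_comm]
  rw [hF]
  have key := VectorFourier.fourierIntegral_comp_add_right 𝐞
    (MeasureTheory.volume : MeasureTheory.Measure V) (innerₗ V) (fun v : V => ((k v : ℝ) : ℂ)) z
  change VectorFourier.fourierIntegral 𝐞 MeasureTheory.volume (innerₗ V)
      ((fun v : V => ((k v : ℝ) : ℂ)) ∘ fun v => v + z) w =
    𝐞 (⟪z, w⟫_ℝ) • VectorFourier.fourierIntegral 𝐞 MeasureTheory.volume (innerₗ V)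
      (fun v : V => ((k v : ℝ) : ℂ)) w
  rw [key]
  simp only [innerₗ_apply_apply]

/-- **Periodisation of a translate through Poisson summation** (real form): for a full lattice
`L` in the plane `V`, `k` continuous with `|k(x)| ≤ C (1 + ‖x‖)⁻³` and real Fourier transform
summable over `L*`, `∑_{l ∈ L} k(z + l) = vol(L)⁻¹ ∑_{w ∈ L*} cos(2π⟪z, w⟫) Re 𝓕k(w)`, as a
`HasSum` statement (the tree's `tsum_eq_tsum_fourier_of_rpow_decay` applied to `k(z + ·)`).
[folklore] -/
theorem latticeForm_hasSum_periodise (L : Submodule ℤ V) [DiscreteTopology L] [IsZLattice ℝ L]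
    {k : V → ℝ} {C : ℝ} (hV : Module.finrank ℝ V = 2) (hk : Continuous k)
    (hdec : ∀ x : V, |k x| ≤ C * (1 + ‖x‖) ^ (-(3 : ℝ)))
    (hreal : ∀ w : V, 0 ≤ (𝓕 (fun v : V => (k v : ℂ)) w).re ∧ (𝓕 (fun v : V => (k v : ℂ)) w).im = 0)
    (hsum : Summable (fun w : dualLattice L => 𝓕 (fun v : V => (k v : ℂ)) (w : V))) (z : V) :
    HasSum (fun w : dualLattice L => (ZLattice.covolume L)⁻¹ *
        (Real.cos (2 * π * ⟪z, (w : V)⟫_ℝ) * (𝓕 (fun v : V => (k v : ℂ)) (w : V)).re))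
      (∑' l : L, k (z + (l : V))) := by
  -- the translate `f_z = k(z + ·)`: continuity and decay with exponent `3 > 2 = dim V`
  have hcont : Continuous fun v : V => ((k (z + v) : ℝ) : ℂ) :=
    Complex.continuous_ofReal.comp (hk.comp (continuous_const.add continuous_id))
  have hb : (Module.finrank ℝ V : ℝ) < 3 := by rw [hV]; norm_num
  have hdec' : ∀ v : V, ‖((k (z + v) : ℝ) : ℂ)‖ ≤ C * (1 + ‖z‖) ^ (3 : ℝ) * (1 + ‖v‖) ^ (-(3 : ℝ)) :=
    latticeForm_norm_translate_le hdec z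
  -- `𝓕k` is absolutely summable over `L*` (it is real and non-negative)
  have hnorm : Summable fun w : dualLattice L => ‖𝓕 (fun v : V => (k v : ℂ)) (w : V)‖ := by
    refine (Complex.hasSum_re hsum.hasSum).summable.congr fun w => ?_
    -- `‖c‖ = Re c` for the real non-negative number `c = 𝓕k(w)`
    obtain ⟨hre, him⟩ := hreal (w : V)
    have hc : 𝓕 (fun v : V => (k v : ℂ)) (w : V) = ((𝓕 (fun v : V => (k v : ℂ)) (w : V)).re : ℂ) :=
      Complex.ext (Complex.ofReal_re _).symm (by rw [Complex.ofReal_im]; exact him)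
    rw [hc, Complex.norm_real, Real.norm_eq_abs, Complex.ofReal_re, abs_of_nonneg hre]
  -- hence so is `𝓕 f_z = 𝐞(⟪z, ·⟫) 𝓕k`
  have hfour : ∀ w : V, 𝓕 (fun v : V => ((k (z + v) : ℝ) : ℂ)) w =
      𝐞 (⟪z, w⟫_ℝ) • 𝓕 (fun v : V => (k v : ℂ)) w := latticeForm_fourier_translate k z
  have hsumf : Summable fun w : dualLattice L => 𝓕 (fun v : V => ((k (z + v) : ℝ) : ℂ)) (w : V) := by
    simp_rw [hfour]
    refine Summable.of_norm (hnorm.congr fun w => ?_)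
    rw [Circle.norm_smul]
  -- Poisson summation for `f_z`
  have key := Literature.NumberTheory.LFunctions.Fourier.tsum_eq_tsum_fourier_of_rpow_decay L
    hcont hb hdec' hsumf
  have h1 : HasSum (fun w : dualLattice L =>
      ((ZLattice.covolume L)⁻¹ : ℝ) • 𝓕 (fun v : V => ((k (z + v) : ℝ) : ℂ)) (w : V))
      (∑' l : L, ((k (z + (l : V)) : ℝ) : ℂ)) := by
    rw [key]
    exact hsumf.hasSum.const_smul _
  -- real parts
  have h2 := Complex.hasSum_re h1
  rw [← Complex.ofReal_tsum, Complex.ofReal_re] at h2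
  have hfun : (fun w : dualLattice L =>
      (((ZLattice.covolume L)⁻¹ : ℝ) • 𝓕 (fun v : V => ((k (z + v) : ℝ) : ℂ)) (w : V)).re) =
      fun w : dualLattice L => (ZLattice.covolume L)⁻¹ *
        (Real.cos (2 * π * ⟪z, (w : V)⟫_ℝ) * (𝓕 (fun v : V => (k v : ℂ)) (w : V)).re) := by
    funext w
    rw [Complex.smul_re, smul_eq_mul, hfour, Circle.smul_def, Real.fourierChar_apply, smul_eq_mul,
      Complex.mul_re, Complex.exp_ofReal_mul_I_re, Complex.exp_ofReal_mul_I_im, (hreal (w : V)).2,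
      mul_zero, sub_zero]
  rw [hfun] at h2
  exact h2

end Periodise

/-- **A kernel with non-negative Fourier transform has a non-negative lattice-periodised quadratic
form** (stub `latticeFormNonneg` of line `Sketch`): for a full lattice `L` in a `2`-dimensional
real inner-product space `V`, `k : V → ℝ` continuous with `|k(x)| ≤ C (1 + ‖x‖)⁻³` and `𝓕k`
pointwise real `≥ 0` and summable over `L*`, every finite signed motif `(p_i, s_i)` satisfies
`0 ≤ ∑_{i,j} s_i s_j ∑_{l ∈ L} k(p_i - p_j + l)`; indeed the left side equals
`vol(L)⁻¹ ∑_{w ∈ L*} Re 𝓕k(w) · ((∑_i s_i cos 2π⟪p_i, w⟫)² + (∑_i s_i sin 2π⟪p_i, w⟫)²)` by Poisson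
summation (`latticeForm_hasSum_periodise`) and `latticeForm_cos_sq`. [folklore] -/
theorem latticeFormNonneg :
    ∀ (V : Type) [NormedAddCommGroup V] [InnerProductSpace ℝ V] [FiniteDimensional ℝ V]
      [MeasurableSpace V] [BorelSpace V] (L : Submodule ℤ V) [DiscreteTopology L] [IsZLattice ℝ L]
      (k : V → ℝ) (C : ℝ), Module.finrank ℝ V = 2 → Continuous k →
      (∀ x : V, |k x| ≤ C * (1 + ‖x‖) ^ (-(3 : ℝ))) →
      (∀ w : V, 0 ≤ (𝓕 (fun v : V => (k v : ℂ)) w).re ∧ (𝓕 (fun v : V => (k v : ℂ)) w).im = 0) →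
      Summable (fun w : dualLattice L => 𝓕 (fun v : V => (k v : ℂ)) (w : V)) →
      ∀ (n : ℕ) (p : Fin n → V) (s : Fin n → ℝ),
        0 ≤ ∑ i, ∑ j, s i * s j * ∑' l : L, k (p i - p j + (l : V)) := by
  intro V _ _ _ _ _ L _ _ k C hV hk hdec hreal hsum n p s
  -- each pair `(i, j)`: the periodised translate as a series over `L*`
  have key : ∀ i j : Fin n, HasSum (fun w : dualLattice L => s i * s j * ((ZLattice.covolume L)⁻¹ *
      (Real.cos (2 * π * ⟪p i - p j, (w : V)⟫_ℝ) * (𝓕 (fun v : V => (k v : ℂ)) (w : V)).re)))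
      (s i * s j * ∑' l : L, k (p i - p j + (l : V))) := fun i j =>
    (latticeForm_hasSum_periodise L hV hk hdec hreal hsum (p i - p j)).mul_left _
  -- the whole quadratic form as one series over `L*`
  have htot : HasSum (fun w : dualLattice L => ∑ i, ∑ j, s i * s j * ((ZLattice.covolume L)⁻¹ *
      (Real.cos (2 * π * ⟪p i - p j, (w : V)⟫_ℝ) * (𝓕 (fun v : V => (k v : ℂ)) (w : V)).re)))
      (∑ i, ∑ j, s i * s j * ∑' l : L, k (p i - p j + (l : V))) :=
    hasSum_sum fun i _ => hasSum_sum fun j _ => key i j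
  -- whose terms are non-negative
  refine htot.nonneg fun w => ?_
  have hc : 0 ≤ (ZLattice.covolume L)⁻¹ :=
    inv_nonneg.2 (ZLattice.covolume_pos L MeasureTheory.volume).le
  have hF : 0 ≤ (𝓕 (fun v : V => (k v : ℂ)) (w : V)).re := (hreal (w : V)).1
  have hcos := latticeForm_cos_sq s (fun i => 2 * π * ⟪p i, (w : V)⟫_ℝ)
  have hexp : ∑ i, ∑ j, s i * s j * ((ZLattice.covolume L)⁻¹ *
      (Real.cos (2 * π * ⟪p i - p j, (w : V)⟫_ℝ) * (𝓕 (fun v : V => (k v : ℂ)) (w : V)).re)) =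
      (ZLattice.covolume L)⁻¹ * (𝓕 (fun v : V => (k v : ℂ)) (w : V)).re *
        ((∑ i, s i * Real.cos (2 * π * ⟪p i, (w : V)⟫_ℝ)) ^ 2 +
          (∑ i, s i * Real.sin (2 * π * ⟪p i, (w : V)⟫_ℝ)) ^ 2) := by
    rw [← hcos, Finset.mul_sum]
    refine Finset.sum_congr rfl fun i _ => ?_
    rw [Finset.mul_sum]
    refine Finset.sum_congr rfl fun j _ => ?_
    rw [inner_sub_left, mul_sub]
    ring
  rw [hexp]
  exact mul_nonneg (mul_nonneg hc hF) (add_nonneg (sq_nonneg _) (sq_nonneg _))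

end Summit.AtomisticToContinuum.Crystallization.Theorems.ChessboardParticlePlanesLjPlaneChessboard

end
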